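import Summits.Ventures.Crystal3D.Theorems.StickyWulffConstantCoaxialWallLawChainTorsion
import HarnessLib

/-!
# THREE-CHAIN TORSION: two steep slots with different second planes pin the jointly registered translation offsets to the
# BASAL ray's cyclic tower (crux `CoaxialWallLaw`, stmt-Ventures-19481, line `WallLedgerF`)

HONEST FRAMING. Venture `Summits/Ventures/Crystal3D` (cell `crystal3d-full`), helper `--supports` the crux `CoaxialWallLaw`
of `route-Ventures-StickyWulffConstant` (REGISTERED line `WallLedgerF`, open stub `stub_coaxialTwoSlabAdhesion`).  Algebra of
lane G's forced rays; rung credit only; F-C1 not moved; NOT the stub.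

Setting: a frame `A`, two slots `u, u'` with `⟪u, u'⟫ = ½` (adjacent rising slots) and a unit menu normal `ν₀` of `A` positive
on both (`⟪Au, ν₀⟫ = ⟪Au', ν₀⟫ = √(2/3)` — the BASAL plane); the second planes through the slots are `n₁ = 2√(2/3)Au − ν₀`,
`n₂ = 2√(2/3)Au' − ν₀` (`⟪ν₀,nᵢ⟫ = ⅓`, `⟪n₁,n₂⟫ = −⅓`).  Three forced rays: `ν₀`, `n₁` (both over `u`) and `n₂` (over `u'`).
* `three_normal_torsion_base`, **`three_chain_torsion`** — JOINT exact order: `a·g⁰_K + b·g¹_K + c·g²_K ∈ A·Λ₀ ⇒ 3^{K+1} ∣ a, b, c`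
  (pair with `ν₀, n₁, n₂`; then the recursion `3g_{K+1} ≡ (12β+5)g_K` of `…ChainCyclic` for each ray).
* **`mem_basal_tower_of_two_registries`** — if a vector lies in BOTH one-sided envelopes `A·Λ₀ + ℤg⁰_K + ℤg¹_K` (slot `u`) and
  `A·Λ₀ + ℤg⁰_K + ℤg²_K` (slot `u'`) at a common level `K`, then it lies in the BASAL TOWER `A·Λ₀ + ℤg⁰_K`.
READING (answers cf-p1's Q1 of 2026-08-28T15:22Z structurally): for TRANSLATION pairs with two steep rising slots, the offsets
registered for BOTH slots are confined to the basal forced ray's cyclic registry — `3` classes at level ⅓ (`Λ₀, ±b_basal`), and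
at deeper levels only the basal tower (numerics calc/reach11.py: 6 new classes at 1/9, 18 at 1/27, = the tower exactly).
WHAT THIS IS NOT: no packing statement (combine with `…ChainTorsionLedger` per slot); not the stub; F-C1 not moved.
-/

noncomputable section

namespace Summit.Ventures.Crystal3D.Theorems

open Summit.Ventures.Crystal3D Finset
open Literature.MathematicalPhysics.StatisticalMechanics (fccStacking barlowStacking IsHaggSeq)
open scoped InnerProductSpace

/-- **Base**: `a·√(2/3)ν₀ + b·√(2/3)n₁ + c·√(2/3)n₂ ∈ A·Λ₀ ⇒ 3 ∣ a, b, c`. -/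
theorem three_normal_torsion_base (A : EuclideanSpace ℝ (Fin 3) ≃ₗᵢ[ℝ] EuclideanSpace ℝ (Fin 3))
    {u u' ν₀ : EuclideanSpace ℝ (Fin 3)} (hu : u ∈ fccSlots) (hu' : u' ∈ fccSlots) (huu : ⟪u, u'⟫_ℝ = 1 / 2)
    (hν : ‖ν₀‖ = 1)
    (hmenu : ∀ w ∈ fccSlots, ⟪A w, ν₀⟫_ℝ = 0 ∨ ⟪A w, ν₀⟫_ℝ = Real.sqrt (2 / 3) ∨ ⟪A w, ν₀⟫_ℝ = -Real.sqrt (2 / 3))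
    (hun : ⟪A u, ν₀⟫_ℝ = Real.sqrt (2 / 3)) (hun' : ⟪A u', ν₀⟫_ℝ = Real.sqrt (2 / 3)) {a b c : ℤ}
    (h : A.symm ((a : ℝ) • (Real.sqrt (2 / 3) • ν₀) + (b : ℝ) • (Real.sqrt (2 / 3) • ((2 * Real.sqrt (2 / 3)) • A u - ν₀)) +
      (c : ℝ) • (Real.sqrt (2 / 3) • ((2 * Real.sqrt (2 / 3)) • A u' - ν₀))) ∈ fccStacking 1 (Real.sqrt (2 / 3))) :
    (3 : ℤ) ∣ a ∧ (3 : ℤ) ∣ b ∧ (3 : ℤ) ∣ c := by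
  set n₁ : EuclideanSpace ℝ (Fin 3) := (2 * Real.sqrt (2 / 3)) • A u - ν₀ with hn₁
  set n₂ : EuclideanSpace ℝ (Fin 3) := (2 * Real.sqrt (2 / 3)) • A u' - ν₀ with hn₂
  have hr : Real.sqrt (2 / 3) ≠ 0 := by positivity
  have h23 : Real.sqrt (2 / 3) * Real.sqrt (2 / 3) = 2 / 3 := Real.mul_self_sqrt (by norm_num)
  have h01 : ⟪ν₀, n₁⟫_ℝ = 1 / 3 := inner_normal_mirror_slot A hν hun
  have h02 : ⟪ν₀, n₂⟫_ℝ = 1 / 3 := inner_normal_mirror_slot A hν hun'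
  have hn₁u : ‖n₁‖ = 1 := norm_mirror_slot A hν hu hun
  have hn₂u : ‖n₂‖ = 1 := norm_mirror_slot A hν hu' hun'
  have hmenu₁ := menu_mirror_slot A hmenu hu hun
  have hmenu₂ := menu_mirror_slot A hmenu hu' hun'
  rw [← hn₁] at hmenu₁; rw [← hn₂] at hmenu₂
  have n00 : ⟪ν₀, ν₀⟫_ℝ = 1 := by rw [real_inner_self_eq_norm_sq, hν, one_pow]
  have n11 : ⟪n₁, n₁⟫_ℝ = 1 := by rw [real_inner_self_eq_norm_sq, hn₁u, one_pow]
  have n22 : ⟪n₂, n₂⟫_ℝ = 1 := by rw [real_inner_self_eq_norm_sq, hn₂u, one_pow]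
  have n10 : ⟪n₁, ν₀⟫_ℝ = 1 / 3 := by rw [real_inner_comm, h01]
  have n20 : ⟪n₂, ν₀⟫_ℝ = 1 / 3 := by rw [real_inner_comm, h02]
  have hAuu : ⟪A u, A u'⟫_ℝ = 1 / 2 := by rw [LinearIsometryEquiv.inner_map_map, huu]
  have h0u' : ⟪ν₀, A u'⟫_ℝ = Real.sqrt (2 / 3) := by rw [real_inner_comm, hun']
  have n12 : ⟪n₁, n₂⟫_ℝ = -(1 / 3) := by
    rw [hn₁, hn₂]
    simp only [inner_sub_left, inner_sub_right, inner_smul_left, inner_smul_right, conj_trivial, hAuu, hun, h0u', n00]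
    nlinarith [h23]
  have n21 : ⟪n₂, n₁⟫_ℝ = -(1 / 3) := by rw [real_inner_comm, n12]
  obtain ⟨j₀, hj₀⟩ := inner_lattice_menu A hmenu h
  obtain ⟨j₁, hj₁⟩ := inner_lattice_menu A hmenu₁ h
  obtain ⟨j₂, hj₂⟩ := inner_lattice_menu A hmenu₂ h
  rw [LinearIsometryEquiv.apply_symm_apply] at hj₀ hj₁ hj₂
  simp only [inner_add_left, inner_smul_left, conj_trivial] at hj₀ hj₁ hj₂
  rw [n00, n10, n20] at hj₀
  rw [h01, n11, n21] at hj₁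
  rw [h02, n12, n22] at hj₂
  have e₀ : ((3 * a + b + c : ℤ) : ℝ) = ((3 * j₀ : ℤ) : ℝ) := by
    push_cast
    have := mul_right_cancel₀ hr (show (a + b * (1 / 3) + c * (1 / 3)) * Real.sqrt (2 / 3) = j₀ * Real.sqrt (2 / 3) by linarith)
    linarith
  have e₁ : ((a + 3 * b - c : ℤ) : ℝ) = ((3 * j₁ : ℤ) : ℝ) := by
    push_cast
    have := mul_right_cancel₀ hr (show (a * (1 / 3) + b + c * (-(1 / 3))) * Real.sqrt (2 / 3) = j₁ * Real.sqrt (2 / 3) by linarith)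
    linarith
  have e₂ : ((a - b + 3 * c : ℤ) : ℝ) = ((3 * j₂ : ℤ) : ℝ) := by
    push_cast
    have := mul_right_cancel₀ hr (show (a * (1 / 3) + b * (-(1 / 3)) + c) * Real.sqrt (2 / 3) = j₂ * Real.sqrt (2 / 3) by linarith)
    linarith
  have i₀ : 3 * a + b + c = 3 * j₀ := by exact_mod_cast e₀
  have i₁ : a + 3 * b - c = 3 * j₁ := by exact_mod_cast e₁
  have i₂ : a - b + 3 * c = 3 * j₂ := by exact_mod_cast e₂
  refine ⟨?_, ?_, ?_⟩ <;> omega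

/-- **THREE-CHAIN JOINT EXACT ORDER**: `a·g⁰_K + b·g¹_K + c·g²_K ∈ A·Λ₀ ⇒ 3^{K+1} ∣ a ∧ 3^{K+1} ∣ b ∧ 3^{K+1} ∣ c` for the rays
of `ν₀` and `n₁ = 2√(2/3)Au − ν₀` over `u` and of `n₂ = 2√(2/3)Au' − ν₀` over `u'`. -/
theorem three_chain_torsion (z : EuclideanSpace ℝ (Fin 3)) (A : EuclideanSpace ℝ (Fin 3) ≃ₗᵢ[ℝ] EuclideanSpace ℝ (Fin 3))
    {u u' ν₀ : EuclideanSpace ℝ (Fin 3)} (hu : u ∈ fccSlots) (hu' : u' ∈ fccSlots) (huu : ⟪u, u'⟫_ℝ = 1 / 2)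
    (hν : ‖ν₀‖ = 1)
    (hmenu : ∀ w ∈ fccSlots, ⟪A w, ν₀⟫_ℝ = 0 ∨ ⟪A w, ν₀⟫_ℝ = Real.sqrt (2 / 3) ∨ ⟪A w, ν₀⟫_ℝ = -Real.sqrt (2 / 3))
    (hun : ⟪A u, ν₀⟫_ℝ = Real.sqrt (2 / 3)) (hun' : ⟪A u', ν₀⟫_ℝ = Real.sqrt (2 / 3)) (K : ℕ) :
    ∀ a b c : ℤ, A.symm ((a : ℝ) • (Real.sqrt (2 / 3) • (forcedTop z ⟨A, u, 0⟩ ν₀ K).nrm) +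
        (b : ℝ) • (Real.sqrt (2 / 3) • (forcedTop z ⟨A, u, 0⟩ ((2 * Real.sqrt (2 / 3)) • A u - ν₀) K).nrm) +
        (c : ℝ) • (Real.sqrt (2 / 3) • (forcedTop z ⟨A, u', 0⟩ ((2 * Real.sqrt (2 / 3)) • A u' - ν₀) K).nrm)) ∈
        fccStacking 1 (Real.sqrt (2 / 3)) →
      ((3 : ℤ) ^ (K + 1)) ∣ a ∧ ((3 : ℤ) ^ (K + 1)) ∣ b ∧ ((3 : ℤ) ^ (K + 1)) ∣ c := by
  set n₁ : EuclideanSpace ℝ (Fin 3) := (2 * Real.sqrt (2 / 3)) • A u - ν₀ with hn₁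
  set n₂ : EuclideanSpace ℝ (Fin 3) := (2 * Real.sqrt (2 / 3)) • A u' - ν₀ with hn₂
  have hn₁u : ‖n₁‖ = 1 := norm_mirror_slot A hν hu hun
  have hn₂u : ‖n₂‖ = 1 := norm_mirror_slot A hν hu' hun'
  have hmenu₁ : ∀ w ∈ fccSlots, ⟪A w, n₁⟫_ℝ = 0 ∨ ⟪A w, n₁⟫_ℝ = Real.sqrt (2 / 3) ∨ ⟪A w, n₁⟫_ℝ = -Real.sqrt (2 / 3) :=
    menu_mirror_slot A hmenu hu hun
  have hmenu₂ : ∀ w ∈ fccSlots, ⟪A w, n₂⟫_ℝ = 0 ∨ ⟪A w, n₂⟫_ℝ = Real.sqrt (2 / 3) ∨ ⟪A w, n₂⟫_ℝ = -Real.sqrt (2 / 3) :=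
    menu_mirror_slot A hmenu hu' hun'
  induction K with
  | zero =>
    intro a b c h
    have e0 : (forcedTop z ⟨A, u, 0⟩ ν₀ 0).nrm = ν₀ := rfl
    have e1 : (forcedTop z ⟨A, u, 0⟩ n₁ 0).nrm = n₁ := rfl
    have e2 : (forcedTop z ⟨A, u', 0⟩ n₂ 0).nrm = n₂ := rfl
    rw [e0, e1, e2] at h
    simpa using three_normal_torsion_base A hu hu' huu hν hmenu hun hun' h
  | succ K ih =>
    intro a b c h
    obtain ⟨⟨β₀, hβ₀⟩, -⟩ := forcedTop_chain_recursion z A u hν hmenu K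
    obtain ⟨⟨β₁, hβ₁⟩, -⟩ := forcedTop_chain_recursion z A u hn₁u hmenu₁ K
    obtain ⟨⟨β₂, hβ₂⟩, -⟩ := forcedTop_chain_recursion z A u' hn₂u hmenu₂ K
    set G₀ := Real.sqrt (2 / 3) • (forcedTop z ⟨A, u, 0⟩ ν₀ (K + 1)).nrm
    set G₁ := Real.sqrt (2 / 3) • (forcedTop z ⟨A, u, 0⟩ n₁ (K + 1)).nrm
    set G₂ := Real.sqrt (2 / 3) • (forcedTop z ⟨A, u', 0⟩ n₂ (K + 1)).nrm
    set g₀ := Real.sqrt (2 / 3) • (forcedTop z ⟨A, u, 0⟩ ν₀ K).nrm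
    set g₁ := Real.sqrt (2 / 3) • (forcedTop z ⟨A, u, 0⟩ n₁ K).nrm
    set g₂ := Real.sqrt (2 / 3) • (forcedTop z ⟨A, u', 0⟩ n₂ K).nrm
    have hsum : A.symm (((a * (12 * β₀ + 5) : ℤ) : ℝ) • g₀ + ((b * (12 * β₁ + 5) : ℤ) : ℝ) • g₁ +
        ((c * (12 * β₂ + 5) : ℤ) : ℝ) • g₂) ∈ fccStacking 1 (Real.sqrt (2 / 3)) := by
      have e : ((a * (12 * β₀ + 5) : ℤ) : ℝ) • g₀ + ((b * (12 * β₁ + 5) : ℤ) : ℝ) • g₁ + ((c * (12 * β₂ + 5) : ℤ) : ℝ) • g₂ =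
          ((3 : ℤ) : ℝ) • ((a : ℝ) • G₀ + (b : ℝ) • G₁ + (c : ℝ) • G₂) -
          ((a : ℝ) • ((3 : ℝ) • G₀ - ((12 * β₀ + 5 : ℤ) : ℝ) • g₀) +
            (b : ℝ) • ((3 : ℝ) • G₁ - ((12 * β₁ + 5 : ℤ) : ℝ) • g₁) +
            (c : ℝ) • ((3 : ℝ) • G₂ - ((12 * β₂ + 5 : ℤ) : ℝ) • g₂)) := by
        push_cast; module
      rw [e]
      exact symm_mem_fcc_sub A (symm_mem_fcc_zsmul A 3 h)
        (symm_mem_fcc_add A (symm_mem_fcc_add A (symm_mem_fcc_zsmul A a hβ₀) (symm_mem_fcc_zsmul A b hβ₁))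
          (symm_mem_fcc_zsmul A c hβ₂))
    obtain ⟨ha, hb, hc⟩ := ih _ _ _ hsum
    have ha' : ((3 : ℤ) ^ (K + 1)) ∣ a := (isCoprime_three_pow_twelve_add_five β₀ (K + 1)).dvd_of_dvd_mul_right ha
    have hb' : ((3 : ℤ) ^ (K + 1)) ∣ b := (isCoprime_three_pow_twelve_add_five β₁ (K + 1)).dvd_of_dvd_mul_right hb
    have hc' : ((3 : ℤ) ^ (K + 1)) ∣ c := (isCoprime_three_pow_twelve_add_five β₂ (K + 1)).dvd_of_dvd_mul_right hc
    obtain ⟨a', rfl⟩ := ha'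
    obtain ⟨b', rfl⟩ := hb'
    obtain ⟨c', rfl⟩ := hc'
    have hsum' : A.symm (((3 ^ K * a' * (12 * β₀ + 5) : ℤ) : ℝ) • g₀ + ((3 ^ K * b' * (12 * β₁ + 5) : ℤ) : ℝ) • g₁ +
        ((3 ^ K * c' * (12 * β₂ + 5) : ℤ) : ℝ) • g₂) ∈ fccStacking 1 (Real.sqrt (2 / 3)) := by
      have e : ((3 ^ K * a' * (12 * β₀ + 5) : ℤ) : ℝ) • g₀ + ((3 ^ K * b' * (12 * β₁ + 5) : ℤ) : ℝ) • g₁ +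
          ((3 ^ K * c' * (12 * β₂ + 5) : ℤ) : ℝ) • g₂ =
          ((((3 : ℤ) ^ (K + 1) * a' : ℤ) : ℝ) • G₀ + (((3 : ℤ) ^ (K + 1) * b' : ℤ) : ℝ) • G₁ +
            (((3 : ℤ) ^ (K + 1) * c' : ℤ) : ℝ) • G₂) -
          (((3 ^ K * a' : ℤ) : ℝ) • ((3 : ℝ) • G₀ - ((12 * β₀ + 5 : ℤ) : ℝ) • g₀) +
            ((3 ^ K * b' : ℤ) : ℝ) • ((3 : ℝ) • G₁ - ((12 * β₁ + 5 : ℤ) : ℝ) • g₁) +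
            ((3 ^ K * c' : ℤ) : ℝ) • ((3 : ℝ) • G₂ - ((12 * β₂ + 5 : ℤ) : ℝ) • g₂)) := by
        push_cast; module
      rw [e]
      exact symm_mem_fcc_sub A h
        (symm_mem_fcc_add A (symm_mem_fcc_add A (symm_mem_fcc_zsmul A _ hβ₀) (symm_mem_fcc_zsmul A _ hβ₁))
          (symm_mem_fcc_zsmul A _ hβ₂))
    obtain ⟨ha2, hb2, hc2⟩ := ih _ _ _ hsum'
    have hdiv : ∀ (x β : ℤ), ((3 : ℤ) ^ (K + 1)) ∣ 3 ^ K * x * (12 * β + 5) → (3 : ℤ) ∣ x := by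
      intro x β hx
      have h1 : ((3 : ℤ) ^ (K + 1)) ∣ 3 ^ K * (x * (12 * β + 5)) := by rw [← mul_assoc]; exact hx
      rw [pow_succ] at h1
      have h2 : (3 : ℤ) ∣ x * (12 * β + 5) := (mul_dvd_mul_iff_left (pow_ne_zero K (by norm_num))).1 h1
      exact (isCoprime_three_pow_twelve_add_five β 1 |>.dvd_of_dvd_mul_right (by simpa using h2))
    obtain ⟨a'', rfl⟩ := hdiv a' β₀ ha2
    obtain ⟨b'', rfl⟩ := hdiv b' β₁ hb2
    obtain ⟨c'', rfl⟩ := hdiv c' β₂ hc2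
    exact ⟨⟨a'', by ring⟩, ⟨b'', by ring⟩, ⟨c'', by ring⟩⟩

/-- **Two one-sided envelopes pin the offset to the basal tower.**  If `v ∈ A·Λ₀ + ℤg⁰_K + ℤg¹_K` (the envelope of the slot
`u`: rays `ν₀`, `n₁`) and `v ∈ A·Λ₀ + ℤg⁰_K + ℤg²_K` (slot `u'`: rays `ν₀`, `n₂`) at a common level `K`, then
`v ∈ A·Λ₀ + ℤg⁰_K` — the BASAL ray's registry. -/
theorem mem_basal_tower_of_two_envelopes (z : EuclideanSpace ℝ (Fin 3))
    (A : EuclideanSpace ℝ (Fin 3) ≃ₗᵢ[ℝ] EuclideanSpace ℝ (Fin 3))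
    {u u' ν₀ : EuclideanSpace ℝ (Fin 3)} (hu : u ∈ fccSlots) (hu' : u' ∈ fccSlots) (huu : ⟪u, u'⟫_ℝ = 1 / 2)
    (hν : ‖ν₀‖ = 1)
    (hmenu : ∀ w ∈ fccSlots, ⟪A w, ν₀⟫_ℝ = 0 ∨ ⟪A w, ν₀⟫_ℝ = Real.sqrt (2 / 3) ∨ ⟪A w, ν₀⟫_ℝ = -Real.sqrt (2 / 3))
    (hun : ⟪A u, ν₀⟫_ℝ = Real.sqrt (2 / 3)) (hun' : ⟪A u', ν₀⟫_ℝ = Real.sqrt (2 / 3)) (K : ℕ) {v : EuclideanSpace ℝ (Fin 3)}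
    (h1 : ∃ a b : ℤ, A.symm (v - (a : ℝ) • (Real.sqrt (2 / 3) • (forcedTop z ⟨A, u, 0⟩ ν₀ K).nrm) -
      (b : ℝ) • (Real.sqrt (2 / 3) • (forcedTop z ⟨A, u, 0⟩ ((2 * Real.sqrt (2 / 3)) • A u - ν₀) K).nrm)) ∈
      fccStacking 1 (Real.sqrt (2 / 3)))
    (h2 : ∃ a b : ℤ, A.symm (v - (a : ℝ) • (Real.sqrt (2 / 3) • (forcedTop z ⟨A, u', 0⟩ ν₀ K).nrm) -
      (b : ℝ) • (Real.sqrt (2 / 3) • (forcedTop z ⟨A, u', 0⟩ ((2 * Real.sqrt (2 / 3)) • A u' - ν₀) K).nrm)) ∈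
      fccStacking 1 (Real.sqrt (2 / 3))) :
    ∃ a : ℤ, A.symm (v - (a : ℝ) • (Real.sqrt (2 / 3) • (forcedTop z ⟨A, u, 0⟩ ν₀ K).nrm)) ∈
      fccStacking 1 (Real.sqrt (2 / 3)) := by
  -- the basal ray over `u'` is the basal ray over `u`: `forcedTop` never reads the bottom direction
  have hray : ∀ k, forcedTop z ⟨A, u', 0⟩ ν₀ k = forcedTop z ⟨A, u, 0⟩ ν₀ k := by
    intro k; induction k with
    | zero => rfl
    | succ k ih => rw [forcedTop_succ, forcedTop_succ, ih]
  obtain ⟨a₁, b₁, h₁⟩ := h1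
  obtain ⟨a₂, b₂, h₂⟩ := h2
  rw [hray K] at h₂
  set G₀ := Real.sqrt (2 / 3) • (forcedTop z ⟨A, u, 0⟩ ν₀ K).nrm
  set G₁ := Real.sqrt (2 / 3) • (forcedTop z ⟨A, u, 0⟩ ((2 * Real.sqrt (2 / 3)) • A u - ν₀) K).nrm
  set G₂ := Real.sqrt (2 / 3) • (forcedTop z ⟨A, u', 0⟩ ((2 * Real.sqrt (2 / 3)) • A u' - ν₀) K).nrm
  -- the difference `(a₂ − a₁) G₀ − b₁ G₁ + b₂ G₂ ∈ M`
  have hdiff : A.symm (((a₂ - a₁ : ℤ) : ℝ) • G₀ + ((-b₁ : ℤ) : ℝ) • G₁ + ((b₂ : ℤ) : ℝ) • G₂) ∈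
      fccStacking 1 (Real.sqrt (2 / 3)) := by
    have e : ((a₂ - a₁ : ℤ) : ℝ) • G₀ + ((-b₁ : ℤ) : ℝ) • G₁ + ((b₂ : ℤ) : ℝ) • G₂ =
        (v - (a₁ : ℝ) • G₀ - (b₁ : ℝ) • G₁) - (v - (a₂ : ℝ) • G₀ - (b₂ : ℝ) • G₂) := by push_cast; module
    rw [e]; exact symm_mem_fcc_sub A h₁ h₂
  obtain ⟨-, hb, -⟩ := three_chain_torsion z A hu hu' huu hν hmenu hun hun' K _ _ _ hdiff
  -- `3^{K+1} ∣ b₁`, and `3^{K+1} G₁ ∈ M`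
  obtain ⟨q, hq⟩ := hb
  have hn₁u : ‖(2 * Real.sqrt (2 / 3)) • A u - ν₀‖ = 1 := norm_mirror_slot A hν hu hun
  have hmenu₁ := menu_mirror_slot A hmenu hu hun
  obtain ⟨-, -, -, -, h7, -⟩ := forcedTop_chain_invariant z A u hn₁u hmenu₁ K
  refine ⟨a₁, ?_⟩
  have e : v - (a₁ : ℝ) • G₀ = (v - (a₁ : ℝ) • G₀ - (b₁ : ℝ) • G₁) + ((-q : ℤ) : ℝ) • (((3 : ℝ) ^ (K + 1)) • G₁) := by
    have hb₁ : (b₁ : ℝ) = -((3 : ℝ) ^ (K + 1) * q) := by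
      have : ((-b₁ : ℤ) : ℝ) = (((3 : ℤ) ^ (K + 1) * q : ℤ) : ℝ) := by rw [hq]
      push_cast at this; linarith
    rw [hb₁]; push_cast; module
  rw [e]
  exact symm_mem_fcc_add A h₁ (symm_mem_fcc_zsmul A _ h7)

end Summit.Ventures.Crystal3D.Theorems

end
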